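import Summits.CriticalPhenomena.Ising3DConformalLimit.Theorems.MoebiusLimitExists.Negative.MeshContinuity
import Summits.CriticalPhenomena.Ising3DConformalLimit.Theorems.MoebiusLimitExists.Negative.PinnedClusterPoints
import Mathlib.Topology.MetricSpace.Algebra
import HarnessLib

/-!
# The crux implies every open stub of line `only-interaction-breaks-moebius`
(crux `MoebiusLimitExists`, item stmt-CriticalPhenomena-1344; refuter `drefute`)

Locally uniform convergence of the pinned zoom under a limit witness
(`tendstoLocallyUniformlyOn_rescaled_pin`: exact factorisation `ρ_pin = r(δ)^{-1/2} ρ` from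
`Negative/PinnedClusterPoints.lean` + Mathlib's `TendstoLocallyUniformlyOn.mul₀_of_isBoundedUnder`,
the limit being locally bounded, `limit_isBoundedUnder`), hence the crux gives STUB 1
(`stub_compactness`) IN FULL (`stub1_of_crux`): regular cluster points — normalised, continuous off
the diagonals by mesh continuity (`Negative/MeshContinuity.lean`), translation invariant. Together
with `stub5_of_crux`, `stub6_of_crux`: `openStubs_of_crux` — the three open stubs of the line follow
from the crux (the other three are theorems), so the line loses nothing against the crux and none
of its stubs is refutable short of refuting `MoebiusLimitExists`.
-/

noncomputable section

open Filter Topology Set Function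
open Literature.Probability.LatticeModels
open Summit.CriticalPhenomena.Ising3DConformalLimit.MoebiusLimitExistsOnlyInteraction
open Summit.CriticalPhenomena.Ising3DConformalLimit.PinnedClusterPoints
open Summit.CriticalPhenomena.Ising3DConformalLimit.LimitMeshContinuity

namespace Summit.CriticalPhenomena.Ising3DConformalLimit.OnlyInteractionTightness

/-! ## Locally uniform convergence of the pinned zoom -/

/-- Composition of locally uniform convergence with a convergent sequence of parameters. [folklore] -/
theorem tendstoLocallyUniformlyOn_comp_tendsto {ι ι' X : Type*} [TopologicalSpace X]
    {F : ι → X → ℝ} {f : X → ℝ} {p : Filter ι} {q : Filter ι'} {s : Set X} {g : ι' → ι}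
    (h : TendstoLocallyUniformlyOn F f p s) (hg : Tendsto g q p) :
    TendstoLocallyUniformlyOn (fun m => F (g m)) f q s := by
  intro u hu x hx
  obtain ⟨t, ht, hev⟩ := h u hu x hx
  exact ⟨t, ht, hg.eventually hev⟩

/-- The rescaled critical correlators are bounded by `|ρ(δ)|ⁿ` (`|⟨∏σ⟩| ≤ 1`). [folklore] -/
theorem abs_rescaledCorrelator_le (ρ : ℝ → ℝ) (n : ℕ) (δ : ℝ)
    (x : Fin n → EuclideanSpace ℝ (Fin 3)) :
    |rescaledCorrelator (criticalCorr 3) ρ n δ x| ≤ |ρ δ| ^ n := by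
  rw [rescaledCorrelator_apply, abs_mul, abs_pow]
  calc |ρ δ| ^ n * |criticalCorr 3 n _| ≤ |ρ δ| ^ n * 1 :=
        mul_le_mul_of_nonneg_left (abs_criticalCorr_le_one le_rfl _ _) (by positivity)
    _ = |ρ δ| ^ n := mul_one _

/-- A pointwise scaling limit is locally bounded on `NonCoincident` (locally uniform limit of
bounded functions). [folklore] -/
theorem limit_isBoundedUnder {ρ : ℝ → ℝ} {S' : CorrFamily 3}
    (hlim : HasPointwiseScalingLimit (criticalCorr 3) ρ S') (n : ℕ)
    {x : Fin n → EuclideanSpace ℝ (Fin 3)} (hx : x ∈ NonCoincident 3 n) :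
    (𝓝[NonCoincident 3 n] x).IsBoundedUnder (· ≤ ·) (fun y => dist (S' n y) 0) := by
  have h := (Metric.tendstoLocallyUniformlyOn_iff.1 (hlim n)) 1 one_pos x hx
  obtain ⟨t, ht, hev⟩ := h
  obtain ⟨δ, hδ⟩ := hev.exists
  refine isBoundedUnder_of_eventually_le (a := |ρ δ| ^ n + 1) ?_
  filter_upwards [ht] with y hy
  have h1 := hδ y hy
  rw [Real.dist_eq] at h1
  rw [Real.dist_eq, sub_zero]
  have h2 := abs_rescaledCorrelator_le ρ n δ y
  have h3 := abs_sub_abs_le_abs_sub (S' n y) (rescaledCorrelator (criticalCorr 3) ρ n δ y)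
  linarith

/-- **Locally uniform convergence of the pinned zoom along any mesh sequence inside `(0,1]`**, for any
non-degenerate limit witness `(ρ, S')`: the limit is `aⁿ S'ₙ`. [folklore] -/
theorem tendstoLocallyUniformlyOn_rescaled_pin {ρ : ℝ → ℝ} {S' : CorrFamily 3}
    (hρ : ∀ δ ∈ Set.Ioc (0:ℝ) 1, 0 < ρ δ)
    (hlim : HasPointwiseScalingLimit (criticalCorr 3) ρ S') (hnd : IsNondegenerateTwoPoint S')
    {v : ℕ → ℝ} (hv : Tendsto v atTop (𝓝[>] (0:ℝ))) (hv1 : ∀ k, v k ∈ Set.Ioc (0:ℝ) 1) (n : ℕ) :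
    TendstoLocallyUniformlyOn (fun k => rescaledCorrelator (criticalCorr 3) rhoPin n (v k))
      (fun x => ((S' 2 (![0, EuclideanSpace.single 0 1] : Fin 2 → EuclideanSpace ℝ (Fin 3))) ^ (-(1 / 2 : ℝ))) ^ n * S' n x) atTop (NonCoincident 3 n) := by
  have hA : 0 < S' 2 (![0, EuclideanSpace.single 0 1] : Fin 2 → EuclideanSpace ℝ (Fin 3)) := hnd _ cfg01_mem
  set r : ℕ → ℝ := fun k => (rescaledCorrelator (criticalCorr 3) ρ 2 (v k) (![0, EuclideanSpace.single 0 1] : Fin 2 → EuclideanSpace ℝ (Fin 3))) ^ (-(1 / 2 : ℝ))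
    with hr
  -- the scalar factor converges
  have hr_t : Tendsto (fun k => r k ^ n) atTop (𝓝 (((S' 2 (![0, EuclideanSpace.single 0 1] : Fin 2 → EuclideanSpace ℝ (Fin 3))) ^ (-(1 / 2 : ℝ))) ^ n)) := by
    have h2 : Tendsto (fun k => rescaledCorrelator (criticalCorr 3) ρ 2 (v k) (![0, EuclideanSpace.single 0 1] : Fin 2 → EuclideanSpace ℝ (Fin 3))) atTop
        (𝓝 (S' 2 (![0, EuclideanSpace.single 0 1] : Fin 2 → EuclideanSpace ℝ (Fin 3)))) := ((hlim 2).tendsto_at cfg01_mem).comp hv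
    exact (h2.rpow_const (p := -(1 / 2 : ℝ)) (Or.inl hA.ne')).pow n
  have hF1 : TendstoLocallyUniformlyOn (fun k (_ : Fin n → EuclideanSpace ℝ (Fin 3)) => r k ^ n)
      (fun _ => ((S' 2 (![0, EuclideanSpace.single 0 1] : Fin 2 → EuclideanSpace ℝ (Fin 3))) ^ (-(1 / 2 : ℝ))) ^ n) atTop (NonCoincident 3 n) :=
    (hr_t.tendstoUniformlyOn_const (NonCoincident 3 n)).tendstoLocallyUniformlyOn
  have hF2 : TendstoLocallyUniformlyOn (fun k => rescaledCorrelator (criticalCorr 3) ρ n (v k))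
      (S' n) atTop (NonCoincident 3 n) :=
    tendstoLocallyUniformlyOn_comp_tendsto (hlim n) hv
  have hprod := hF1.mul₀_of_isBoundedUnder hF2
    (fun x _ => isBoundedUnder_of ⟨dist ((((S' 2 (![0, EuclideanSpace.single 0 1] : Fin 2 → EuclideanSpace ℝ (Fin 3))) ^ (-(1 / 2 : ℝ))) ^ n)) 0, fun _ => le_rfl⟩)
    (fun x hx => limit_isBoundedUnder hlim n hx)
  have heq : (fun k => rescaledCorrelator (criticalCorr 3) rhoPin n (v k)) =
      (fun k (_ : Fin n → EuclideanSpace ℝ (Fin 3)) => r k ^ n) *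
        (fun k => rescaledCorrelator (criticalCorr 3) ρ n (v k)) := by
    funext k x
    exact rescaled_pin_eq (hρ _ (hv1 k)) n x
  rw [heq]
  exact hprod


/-! ## STUB 1 in full from the crux, and the certificate -/

open Classical in
/-- **crux ⇒ STUB 1 in full** (`stub_compactness`, verbatim conclusion): under the crux every mesh
sequence has a subsequence (a tail) along which the pinned zoom converges locally uniformly off
the diagonals, for all `n`, to ONE REGULAR family — normalised, continuous on `NonCoincident`
(mesh continuity of the witness), translation invariant. [folklore] -/
theorem stub1_of_crux (h : Summit.CriticalPhenomena.Ising3DConformalLimit.Theses.EnergyNotSigmaSquared.MoebiusLimit) :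
    ∀ u : ℕ → ℝ, Tendsto u atTop (𝓝[>] (0 : ℝ)) →
      ∃ (φ : ℕ → ℕ) (S : CorrFamily 3), StrictMono φ ∧ Summit.CriticalPhenomena.Ising3DConformalLimit.MoebiusLimitExistsOnlyInteraction.IsRegular S ∧
        ∀ n, TendstoLocallyUniformlyOn
          (fun k => rescaledCorrelator (criticalCorr 3) rhoPin n (u (φ k))) (S n) atTop
          (NonCoincident 3 n) := by
  obtain ⟨ρ, Δ', S', hρ, -, hlim, hnd, hmoeb⟩ := h
  intro u hu
  -- a tail of `u` lies in `(0,1]`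
  obtain ⟨K, hK⟩ := eventually_atTop.1 (hu.eventually (Ioc_mem_nhdsGT one_pos))
  set a : ℝ := (S' 2 (![0, EuclideanSpace.single 0 1] : Fin 2 → EuclideanSpace ℝ (Fin 3))) ^ (-(1 / 2 : ℝ)) with ha
  refine ⟨fun k => k + K, fun n x => if x ∈ NonCoincident 3 n then a ^ n * S' n x else 0,
    fun i j hij => by dsimp only; omega, ⟨fun n x hx => if_neg hx, fun n => ?_, ?_⟩, fun n => ?_⟩
  · -- continuity on `NonCoincident`: mesh continuity of the witness `S'`
    refine ((continuousOn_const (c := a ^ n)).mul (continuousOn_limit hlim n)).congr ?_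
    intro x hx
    simp only [if_pos hx, Pi.mul_apply]
  · -- translation invariance
    intro n v x
    have hiff : (fun i => x i + v) ∈ NonCoincident 3 n ↔ x ∈ NonCoincident 3 n := by
      rw [mem_nonCoincident, mem_nonCoincident]
      exact (add_left_injective v).of_comp_iff x
    by_cases hx : x ∈ NonCoincident 3 n
    · simp only [if_pos hx, if_pos (hiff.2 hx), hmoeb.1.1 n v x]
    · simp only [if_neg hx, if_neg (mt hiff.1 hx)]
  · have hv : Tendsto (fun k => u (k + K)) atTop (𝓝[>] (0:ℝ)) := hu.comp (tendsto_add_atTop_nat K)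
    have hv1 : ∀ k, u (k + K) ∈ Set.Ioc (0:ℝ) 1 := fun k => hK _ (Nat.le_add_left K k)
    refine (tendstoLocallyUniformlyOn_rescaled_pin hρ hlim hnd hv hv1 n).congr_right fun x hx => ?_
    simp only [if_pos hx, ha]

/-- **CERTIFICATE: the crux implies all three OPEN stubs of the line** — `stub_compactness`
(verbatim), `stub_interactingInversion` and `stub_interactingUnique` (verbatim, from the
strengthened `stub5_of_crux` / `stub6_of_crux`); the other three stubs are theorems. The line
`only-interaction-breaks-moebius` loses nothing against the crux, and none of its stubs is
refutable short of refuting `MoebiusLimitExists` itself. [folklore] -/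
theorem openStubs_of_crux (h : Summit.CriticalPhenomena.Ising3DConformalLimit.Theses.EnergyNotSigmaSquared.MoebiusLimit) :
    (∀ u : ℕ → ℝ, Tendsto u atTop (𝓝[>] (0 : ℝ)) →
      ∃ (φ : ℕ → ℕ) (S : CorrFamily 3), StrictMono φ ∧ Summit.CriticalPhenomena.Ising3DConformalLimit.MoebiusLimitExistsOnlyInteraction.IsRegular S ∧
        ∀ n, TendstoLocallyUniformlyOn
          (fun k => rescaledCorrelator (criticalCorr 3) rhoPin n (u (φ k))) (S n) atTop
          (NonCoincident 3 n)) ∧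
    (∀ (Δ : ℝ) (S : CorrFamily 3), IsClusterPoint S → Summit.CriticalPhenomena.Ising3DConformalLimit.MoebiusLimitExistsOnlyInteraction.IsRegular S →
      (∀ x ∈ NonCoincident 3 2, S 2 x = ‖x 0 - x 1‖ ^ (-(2 * Δ))) →
      HasNontrivialU4 S → IsInversionCovariant Δ S) ∧
    (∀ (Δ : ℝ) (S₁ S₂ : CorrFamily 3), IsClusterPoint S₁ → IsClusterPoint S₂ →
      Summit.CriticalPhenomena.Ising3DConformalLimit.MoebiusLimitExistsOnlyInteraction.IsRegular S₁ → Summit.CriticalPhenomena.Ising3DConformalLimit.MoebiusLimitExistsOnlyInteraction.IsRegular S₂ →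
      (∀ x ∈ NonCoincident 3 2, S₁ 2 x = ‖x 0 - x 1‖ ^ (-(2 * Δ))) →
      (∀ x ∈ NonCoincident 3 2, S₂ 2 x = ‖x 0 - x 1‖ ^ (-(2 * Δ))) →
      HasNontrivialU4 S₁ → ∀ n, (NonCoincident 3 n).EqOn (S₁ n) (S₂ n)) :=
  ⟨stub1_of_crux h,
    fun Δ S hS hreg h2 _ => stub5_of_crux h Δ S hS hreg.1 h2,
    fun _ S₁ S₂ h₁ h₂ _ _ _ _ _ => stub6_of_crux h S₁ S₂ h₁ h₂⟩

end Summit.CriticalPhenomena.Ising3DConformalLimit.OnlyInteractionTightness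

end
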